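import Mathlib
import Literature.AlgebraicGeometry.HyperbolicPolynomials.SpectrahedralShadow
import Literature.AlgebraicGeometry.HyperbolicPolynomials.ElementarySymmetricCone
import Literature.AlgebraicGeometry.HyperbolicPolynomials.CompressionDeterminant
import Literature.Analysis.Convex.SpectralConeLift
import HarnessLib

/-!
# Proof of Saunderson–Parrilo, Theorem 1 (orthant form): polynomial-sized semidefinite
# representations of the derivative relaxations of the orthant

Topic `Literature/AlgebraicGeometry/HyperbolicPolynomials`. This file discharges the named fact
`SaundersonParrilo2014_thm1_orthant` of `SpectrahedralShadow.lean`: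
for `1 ≤ k ≤ n-1` the hyperbolicity cone `ℝ^{n,(k)}_+ = Λ₊(e_{n-k}, 𝟙)` has a lifted LMI
representation of size `≤ C · min{k, n-k} · n²` (here `C = 8`).

The proof follows Saunderson–Parrilo (Math. Program. 153 (2015), arXiv:1208.1443) §2–§4,
specialised to the orthant throughout (we never introduce the cones `S^{n,(k)}_+` as separate
objects: the spectral set `spec Λ₊(e_d, 𝟙) = {U diag(z) Uᵀ : z ∈ Λ₊(e_d, 𝟙)}` plays their role):

* `mem_cone_iff_compression_mem_spec` — **Prop. 2** (derivative-based step):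
  `x ∈ Λ₊^{n+1}(e_d) ↔ Vᵀ diag(x) V ∈ spec Λ₊^{n}(e_d)` (`d ≤ n`), from the coefficient identity
  `(n+1) e_j(λ(Vᵀ diag(x) V)) = (n+1-j) e_j(x)` (`CompressionDeterminant`).
* `mem_cone_iff_exists_spec_schur` — **Prop. 3** (polar step): for `2 ≤ d ≤ n`,
  `x ∈ Λ₊^{n+1}(e_d) ↔ ∃ Z ∈ spec Λ₊^{n}(e_{d-1}), diag(x) ⪰ V Z Vᵀ`, from
  `e₁(x) e_j(λ(S(x))) = (j+1) e_{j+1}(x)` for the Schur complement `S(x)` and a direct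
  quadratic-form version of the Schur-complement lemma (Lemma 2).
* the lifts: `spec` of a represented permutation-invariant cone is represented with
  `O(n²)` more psd size (`Literature.Analysis.Convex.hasExpPsdLift_spectralSet`, Prop. 1), the base
  cases `Λ₊(e_n, 𝟙) = ℝⁿ₊` (size `n`) and `Λ₊(e₁, 𝟙)` = half-space (size `1`), and the two
  recursions (2.2): derivative-based of size `O(k n²)` and polar of size `O((n-k) n²)`.
* `SaundersonParrilo2014_thm1_orthant_holds`.

Bookkeeping is done with `Literature.Analysis.Convex.HasExpPsdLift C 0 m` (a lifted LMI
representation with one psd block of order `m` and free lifting variables), which for subsets of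
`ℝ^σ` is the same as `IsSpectrahedralShadowOfSize C m`
(`isSpectrahedralShadowOfSize_of_hasExpPsdLift`).

## References

* [SaundersonParrilo2014] J. Saunderson, P. A. Parrilo, Math. Program. 153 (2015) 309–331
  (arXiv:1208.1443): Thm. 1, Props. 1–3, §2.2 (sizes), Lemmas 1–4, 6–8.
-/

noncomputable section

open Matrix Finset MvPolynomial
open Literature.Analysis.Convex
open scoped BigOperators

namespace Literature.AlgebraicGeometry.HyperbolicPolynomials

/-! ### Bridge between the two bookkeepings -/

/-- A `K_exp⁰ × S^m_+`-lift is a lifted LMI representation of size `m`. [folklore] -/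
theorem isSpectrahedralShadowOfSize_of_hasExpPsdLift {σ : Type*} {K : Set (σ → ℝ)} {m : ℕ}
    (h : HasExpPsdLift K 0 m) : IsSpectrahedralShadowOfSize K m := by
  obtain ⟨p, A, b, hK⟩ := h
  refine ⟨p, (LinearMap.snd ℝ _ _).comp A, b.2, fun x => ?_⟩
  rw [hK]
  simp only [Set.mem_setOf_eq, mem_expPsdCone_iff, IsEmpty.forall_iff, true_and,
    LinearMap.comp_apply, LinearMap.snd_apply, Prod.snd_add]

/-! ### Notation-free abbreviations used below

`cone N d = Λ₊(e_d, 𝟙) ⊆ ℝ^N` and `spec K = {U diag(z) Uᵀ : U Uᵀ = I, z ∈ K}` are written out in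
full in every statement (no new definitions are introduced in this proof file). -/

section Spec

variable {N : ℕ}

/-- Scaling a point of a spectral set: `c • (U diag(z) Uᵀ) = U diag(c • z) Uᵀ`. [folklore] -/
theorem smul_conj_diagonal (U : Matrix (Fin N) (Fin N) ℝ) (z : Fin N → ℝ) (c : ℝ) :
    c • (U * diagonal z * Uᵀ) = U * diagonal (c • z) * Uᵀ := by
  rw [diagonal_smul, Matrix.mul_smul, Matrix.smul_mul]

/-- A spectral set over a cone is a cone, and over a convex cone it is closed under addition
(given its convexity). [folklore] -/
theorem add_mem_spec_of_convex {K : Set (Fin N → ℝ)}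
    (hsmul : ∀ z ∈ K, ∀ c : ℝ, 0 < c → c • z ∈ K)
    (hconv : Convex ℝ {Y : Matrix (Fin N) (Fin N) ℝ | ∃ U : Matrix (Fin N) (Fin N) ℝ, U * Uᵀ = 1 ∧
      ∃ z ∈ K, Y = U * diagonal z * Uᵀ})
    {Y₁ Y₂ : Matrix (Fin N) (Fin N) ℝ}
    (h₁ : Y₁ ∈ {Y : Matrix (Fin N) (Fin N) ℝ | ∃ U : Matrix (Fin N) (Fin N) ℝ, U * Uᵀ = 1 ∧
      ∃ z ∈ K, Y = U * diagonal z * Uᵀ})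
    (h₂ : Y₂ ∈ {Y : Matrix (Fin N) (Fin N) ℝ | ∃ U : Matrix (Fin N) (Fin N) ℝ, U * Uᵀ = 1 ∧
      ∃ z ∈ K, Y = U * diagonal z * Uᵀ}) :
    Y₁ + Y₂ ∈ {Y : Matrix (Fin N) (Fin N) ℝ | ∃ U : Matrix (Fin N) (Fin N) ℝ, U * Uᵀ = 1 ∧
      ∃ z ∈ K, Y = U * diagonal z * Uᵀ} := by
  have hmid := hconv h₁ h₂ (show (0 : ℝ) ≤ 1 / 2 by norm_num) (show (0 : ℝ) ≤ 1 / 2 by norm_num)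
    (by norm_num)
  obtain ⟨U, hU, z, hz, hYz⟩ := hmid
  refine ⟨U, hU, (2 : ℝ) • z, hsmul z hz 2 two_pos, ?_⟩
  rw [← smul_conj_diagonal, ← hYz, smul_add, smul_smul, smul_smul]
  norm_num

end Spec

/-! ### Proposition 2: the derivative-based step -/

section Prop2

variable {n : ℕ} {V : Matrix (Fin (n + 1)) (Fin n) ℝ}
  (hV3 : V * Vᵀ = 1 - ((n : ℝ) + 1)⁻¹ • Matrix.of (fun _ _ => (1 : ℝ)))
include hV3

/-- **Saunderson–Parrilo, Proposition 2** (orthant/spectral form): for `d ≤ n`,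
`x ∈ Λ₊^{ℝ^{n+1}}(e_d, 𝟙)` iff the compression `Vᵀ diag(x) V` is `U diag(z) Uᵀ` with `U`
orthogonal and `z ∈ Λ₊^{ℝⁿ}(e_d, 𝟙)` ("`ℝ^{n,(k)}_+ = {x : V_nᵀ diag(x) V_n ∈ S^{n-1,(k-1)}_+}`").
[cite: SaundersonParrilo2014, Proposition 2] -/
theorem mem_cone_iff_compression_mem_spec {d : ℕ} (hd : d ≤ n) (x : Fin (n + 1) → ℝ) :
    x ∈ hyperbolicityCone (esymm (Fin (n + 1)) ℝ d) (fun _ => (1 : ℝ)) ↔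
      ∃ U : Matrix (Fin n) (Fin n) ℝ, U * Uᵀ = 1 ∧
        ∃ z ∈ hyperbolicityCone (esymm (Fin n) ℝ d) (fun _ => (1 : ℝ)),
          Vᵀ * diagonal x * V = U * diagonal z * Uᵀ := by
  have hdn : d ≤ Fintype.card (Fin n) := by simpa using hd
  have hdN : d ≤ Fintype.card (Fin (n + 1)) := by simp; omega
  constructor
  · intro hx
    rw [mem_hyperbolicityCone_esymm_iff hdN] at hx
    have hsymm : (Vᵀ * diagonal x * V).IsHermitian := by
      rw [Matrix.IsHermitian, conjTranspose_eq_transpose_of_trivial, transpose_mul, transpose_mul,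
        diagonal_transpose, transpose_transpose, Matrix.mul_assoc]
    obtain ⟨U, hU, hY⟩ := exists_orthogonal_conj_diagonal hsymm
    refine ⟨U, hU, _, ?_, hY⟩
    rw [mem_hyperbolicityCone_esymm_iff hdn]
    intro j hj
    have hid := esymm_eigenvalues_compression hV3 x hU hY (hj.trans hd)
    have hpos : (0 : ℝ) < (n : ℝ) + 1 := by positivity
    have hcoef : (0 : ℝ) ≤ (n : ℝ) + 1 - j := by
      have : (j : ℝ) ≤ n := by exact_mod_cast hj.trans hd
      linarith
    have h := mul_nonneg hcoef (hx j hj)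
    rw [← hid] at h
    exact nonneg_of_mul_nonneg_right h hpos
  · rintro ⟨U, hU, z, hz, hY⟩
    rw [mem_hyperbolicityCone_esymm_iff hdn] at hz
    rw [mem_hyperbolicityCone_esymm_iff hdN]
    intro j hj
    have hid := esymm_eigenvalues_compression hV3 x hU hY (hj.trans hd)
    have hcoef : (0 : ℝ) < (n : ℝ) + 1 - j := by
      have : (j : ℝ) ≤ n := by exact_mod_cast hj.trans hd
      linarith
    have h := mul_nonneg (show (0 : ℝ) ≤ (n : ℝ) + 1 by positivity) (hz j hj)
    rw [hid] at h
    exact nonneg_of_mul_nonneg_right h hcoef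

end Prop2

/-! ### Proposition 3: the polar step -/

section Prop3

variable {n : ℕ} {V : Matrix (Fin (n + 1)) (Fin n) ℝ} (hV1 : Vᵀ * V = 1)
  (hV2 : Vᵀ *ᵥ (fun _ => (1 : ℝ)) = 0)
  (hV3 : V * Vᵀ = 1 - ((n : ℝ) + 1)⁻¹ • Matrix.of (fun _ _ => (1 : ℝ)))

/-- `J w = (∑ w) 𝟙`. [folklore] -/
theorem of_one_mulVec (w : Fin (n + 1) → ℝ) :
    (Matrix.of (fun _ _ => (1 : ℝ)) : Matrix (Fin (n + 1)) (Fin (n + 1)) ℝ) *ᵥ w =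
      fun _ => ∑ i, w i := by
  funext i
  simp [mulVec, dotProduct]

include hV3 in
/-- Decomposition along `𝟙`: `V (Vᵀ w) = w - ((∑ w)/(n+1)) 𝟙`. [folklore] -/
theorem mulVec_transpose_mulVec (w : Fin (n + 1) → ℝ) :
    V *ᵥ (Vᵀ *ᵥ w) = w - (((n : ℝ) + 1)⁻¹ * ∑ i, w i) • fun _ => (1 : ℝ) := by
  rw [mulVec_mulVec, hV3, sub_mulVec, one_mulVec, smul_mulVec, of_one_mulVec]
  congr 1
  funext i
  simp

include hV1 hV2 in
/-- `Vᵀ (V u + c 𝟙) = u`. [folklore] -/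
theorem transpose_mulVec_add (u : Fin n → ℝ) (c : ℝ) :
    Vᵀ *ᵥ (V *ᵥ u + c • fun _ => (1 : ℝ)) = u := by
  rw [mulVec_add, mulVec_smul, hV2, smul_zero, add_zero, mulVec_mulVec, hV1, one_mulVec]

/-- Quadratic form of a congruence: `w ⬝ (V M Vᵀ) w = (Vᵀ w) ⬝ M (Vᵀ w)`. [folklore] -/
theorem dotProduct_conj_mulVec (M : Matrix (Fin n) (Fin n) ℝ) (w : Fin (n + 1) → ℝ) :
    w ⬝ᵥ ((V * M * Vᵀ) *ᵥ w) = (Vᵀ *ᵥ w) ⬝ᵥ (M *ᵥ (Vᵀ *ᵥ w)) := by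
  rw [← mulVec_mulVec, ← mulVec_mulVec, dotProduct_mulVec, ← mulVec_transpose]

include hV1 hV2 in
/-- **Master quadratic-form identity** (a direct form of the Schur-complement step, Lemma 2): for
`w = V u + c 𝟙`,
`wᵀ (diag(x) - V M Vᵀ) w = uᵀ (Vᵀ diag(x) V - M) u + 2c (Vᵀx)ᵀu + c² e₁(x)`. [folklore] -/
theorem quadForm_add_smul_one (M : Matrix (Fin n) (Fin n) ℝ) (x : Fin (n + 1) → ℝ)
    (u : Fin n → ℝ) (c : ℝ) :
    (V *ᵥ u + c • fun _ => (1 : ℝ)) ⬝ᵥ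
        ((diagonal x - V * M * Vᵀ) *ᵥ (V *ᵥ u + c • fun _ => (1 : ℝ))) =
      u ⬝ᵥ ((Vᵀ * diagonal x * V - M) *ᵥ u) + 2 * c * ((Vᵀ *ᵥ x) ⬝ᵥ u) +
        c ^ 2 * ∑ i, x i := by
  set y := V *ᵥ u with hy
  set e : Fin (n + 1) → ℝ := fun _ => 1 with he
  have hVt : Vᵀ *ᵥ (y + c • e) = u := transpose_mulVec_add hV1 hV2 u c
  have hA : (y + c • e) ⬝ᵥ ((V * M * Vᵀ) *ᵥ (y + c • e)) = u ⬝ᵥ (M *ᵥ u) := by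
    rw [dotProduct_conj_mulVec, hVt]
  have hDe : diagonal x *ᵥ e = x := by
    funext i
    simp [he, mulVec_diagonal]
  have hB1 : y ⬝ᵥ (diagonal x *ᵥ y) = u ⬝ᵥ ((Vᵀ * diagonal x * V) *ᵥ u) := by
    rw [hy, ← mulVec_mulVec, ← mulVec_mulVec, dotProduct_mulVec u Vᵀ, vecMul_transpose]
  have hB2 : y ⬝ᵥ (diagonal x *ᵥ e) = (Vᵀ *ᵥ x) ⬝ᵥ u := by
    rw [hDe, hy, dotProduct_comm, dotProduct_mulVec, ← mulVec_transpose]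
  have hB3 : e ⬝ᵥ (diagonal x *ᵥ y) = (Vᵀ *ᵥ x) ⬝ᵥ u := by
    have : e ⬝ᵥ (diagonal x *ᵥ y) = x ⬝ᵥ y := by
      simp [he, dotProduct, mulVec_diagonal]
    rw [this, hy, dotProduct_mulVec, ← mulVec_transpose]
  have hB4 : e ⬝ᵥ (diagonal x *ᵥ e) = ∑ i, x i := by
    rw [hDe]
    simp [he, dotProduct]
  rw [sub_mulVec, dotProduct_sub, hA, mulVec_add, mulVec_smul, add_dotProduct, dotProduct_add,
    dotProduct_add, dotProduct_smul, dotProduct_smul, smul_dotProduct, smul_dotProduct, hB1, hB2,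
    hB3, hB4, sub_mulVec, dotProduct_sub]
  simp only [smul_eq_mul]
  ring

omit hV1 hV2 hV3 in
/-- `Vᵀ diag(x) V` is symmetric. [folklore] -/
theorem isHermitian_compression (x : Fin (n + 1) → ℝ) : (Vᵀ * diagonal x * V).IsHermitian := by
  rw [Matrix.IsHermitian, conjTranspose_eq_transpose_of_trivial, transpose_mul, transpose_mul,
    diagonal_transpose, transpose_transpose, Matrix.mul_assoc]

omit hV1 hV2 hV3 in
/-- The Schur complement `Vᵀ diag(x) V - s⁻¹ (Vᵀx)(Vᵀx)ᵀ` is symmetric. [folklore] -/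
theorem isHermitian_schur (x : Fin (n + 1) → ℝ) (s : ℝ) :
    (Vᵀ * diagonal x * V - s⁻¹ • vecMulVec (Vᵀ *ᵥ x) (Vᵀ *ᵥ x)).IsHermitian := by
  refine (isHermitian_compression x).sub ?_
  rw [Matrix.IsHermitian, conjTranspose_eq_transpose_of_trivial, transpose_smul,
    transpose_vecMulVec]

/-- `U diag(z) Uᵀ` is symmetric. [folklore] -/
theorem isHermitian_conj_diagonal {m : Type*} [Fintype m] [DecidableEq m] (U : Matrix m m ℝ)
    (z : m → ℝ) : (U * diagonal z * Uᵀ).IsHermitian := by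
  rw [Matrix.IsHermitian, conjTranspose_eq_transpose_of_trivial, transpose_mul, transpose_mul,
    diagonal_transpose, transpose_transpose, Matrix.mul_assoc]

omit hV1 hV2 hV3 in
/-- `diag(x) - V M Vᵀ` is symmetric for symmetric `M`. [folklore] -/
theorem isHermitian_diagonal_sub_conj {M : Matrix (Fin n) (Fin n) ℝ} (hM : M.IsHermitian)
    (x : Fin (n + 1) → ℝ) : (diagonal x - V * M * Vᵀ).IsHermitian := by
  have hMt : Mᵀ = M := by
    have := hM
    rwa [Matrix.IsHermitian, conjTranspose_eq_transpose_of_trivial] at this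
  rw [Matrix.IsHermitian, conjTranspose_eq_transpose_of_trivial, transpose_sub, diagonal_transpose,
    transpose_mul, transpose_mul, transpose_transpose, hMt, Matrix.mul_assoc]

include hV1 hV2 hV3 in
/-- **Saunderson–Parrilo, Proposition 3** (orthant/spectral form): for `1 ≤ d`, `d + 1 ≤ n`,
`x ∈ Λ₊^{ℝ^{n+1}}(e_{d+1}, 𝟙)` iff there is `Z = U diag(z) Uᵀ` with `U` orthogonal and
`z ∈ Λ₊^{ℝⁿ}(e_d, 𝟙)` such that `diag(x) - V Z Vᵀ ⪰ 0`
("`ℝ^{n,(k)}_+ = {x : ∃ Z ∈ S^{n-1,(k)}_+ s.t. diag(x) ⪰ V_n Z V_nᵀ}`, `1 ≤ k ≤ n-2`). The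
convexity of the spectral set, used in the printed proof through "`S^{n-1,(k)}_+ + S^{n-1}_+ =
S^{n-1,(k)}_+`", is taken as a hypothesis (it follows from its semidefinite representation).
[cite: SaundersonParrilo2014, Proposition 3] -/
theorem mem_cone_iff_exists_spec_schur {d : ℕ} (hd1 : 1 ≤ d) (hd : d + 1 ≤ n)
    (hconv : Convex ℝ {Y : Matrix (Fin n) (Fin n) ℝ | ∃ U : Matrix (Fin n) (Fin n) ℝ, U * Uᵀ = 1 ∧
      ∃ z ∈ hyperbolicityCone (esymm (Fin n) ℝ d) (fun _ => (1 : ℝ)),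
        Y = U * diagonal z * Uᵀ})
    (x : Fin (n + 1) → ℝ) :
    x ∈ hyperbolicityCone (esymm (Fin (n + 1)) ℝ (d + 1)) (fun _ => (1 : ℝ)) ↔
      ∃ Z ∈ {Y : Matrix (Fin n) (Fin n) ℝ | ∃ U : Matrix (Fin n) (Fin n) ℝ, U * Uᵀ = 1 ∧
        ∃ z ∈ hyperbolicityCone (esymm (Fin n) ℝ d) (fun _ => (1 : ℝ)),
          Y = U * diagonal z * Uᵀ}, (diagonal x - V * Z * Vᵀ).PosSemidef := by
  classical
  have hdn : d ≤ Fintype.card (Fin n) := by simp; omega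
  have hdN : d + 1 ≤ Fintype.card (Fin (n + 1)) := by simp; omega
  set s : ℝ := ∑ i, x i with hs_def
  set y : Fin n → ℝ := Vᵀ *ᵥ x with hy_def
  set S : Matrix (Fin n) (Fin n) ℝ := Vᵀ * diagonal x * V - s⁻¹ • vecMulVec y y with hS_def
  -- the quadratic form of `Vᵀ diag(x) V - S = s⁻¹ y yᵀ`
  have hvv : ∀ u : Fin n → ℝ, vecMulVec y y *ᵥ u = (y ⬝ᵥ u) • y := by
    intro u
    funext i
    simp only [mulVec, dotProduct, vecMulVec_apply, Pi.smul_apply, smul_eq_mul]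
    rw [Finset.sum_mul]
    exact Finset.sum_congr rfl fun j _ => by ring
  have hquadS : ∀ u : Fin n → ℝ,
      u ⬝ᵥ ((Vᵀ * diagonal x * V - S) *ᵥ u) = s⁻¹ * (y ⬝ᵥ u) ^ 2 := by
    intro u
    rw [hS_def, sub_sub_cancel, smul_mulVec, hvv, dotProduct_smul, dotProduct_smul,
      dotProduct_comm u y, smul_eq_mul, smul_eq_mul]
    ring
  -- Renegar descriptions
  rw [mem_hyperbolicityCone_esymm_iff hdN]
  have hspec_iff : ∀ z : Fin n → ℝ,
      z ∈ hyperbolicityCone (esymm (Fin n) ℝ d) (fun _ => (1 : ℝ)) ↔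
        ∀ j ≤ d, 0 ≤ MvPolynomial.eval z (esymm (Fin n) ℝ j) :=
    fun z => mem_hyperbolicityCone_esymm_iff hdn z
  constructor
  · intro hx
    have hs0 : 0 ≤ s := by
      have := hx 1 (by omega)
      rwa [eval_esymm_one_eq_sum] at this
    rcases hs0.lt_or_eq with hs | hs
    · -- `e₁(x) > 0`: take `Z = S`, the Schur complement
      obtain ⟨U, hU, hSU⟩ := exists_orthogonal_conj_diagonal (isHermitian_schur (V := V) x s)
      refine ⟨S, ⟨U, hU, _, ?_, hSU⟩, ?_⟩
      · rw [hspec_iff]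
        intro j hj
        have hid := esymm_eigenvalues_schurCompression hV3 x hs.ne' hU hSU (by omega : j ≤ n)
        have h := mul_nonneg (show (0 : ℝ) ≤ (j : ℝ) + 1 by positivity) (hx (j + 1) (by omega))
        rw [← hid] at h
        exact nonneg_of_mul_nonneg_right h hs
      · refine PosSemidef.of_dotProduct_mulVec_nonneg
          (isHermitian_diagonal_sub_conj (isHermitian_schur x s) x) fun w => ?_
        rw [star_trivial]
        -- decompose `w = V u + c 𝟙`
        set u := Vᵀ *ᵥ w with hu
        set c : ℝ := ((n : ℝ) + 1)⁻¹ * ∑ i, w i with hc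
        have hw : w = V *ᵥ u + c • fun _ => (1 : ℝ) := by
          rw [hu, mulVec_transpose_mulVec hV3 w, hc, sub_add_cancel]
        rw [hw, quadForm_add_smul_one hV1 hV2 S x u c, hquadS u]
        have hsq : s⁻¹ * (y ⬝ᵥ u) ^ 2 + 2 * c * (y ⬝ᵥ u) + c ^ 2 * s =
            s⁻¹ * (y ⬝ᵥ u + c * s) ^ 2 := by
          field_simp
          ring
        rw [hsq]
        exact mul_nonneg (inv_nonneg.2 hs.le) (sq_nonneg _)
    · -- `e₁(x) = 0`: then `x = 0`, take `Z = 0`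
      have hx0 : x = 0 :=
        eq_zero_of_esymm_one_eq_zero hs.symm (hx 2 (by omega))
      refine ⟨0, ⟨1, by simp, 0, ?_, by simp⟩, ?_⟩
      · exact zero_mem_hyperbolicityCone_esymm hdn
      · rw [hx0, Matrix.mul_zero, Matrix.zero_mul, sub_zero]
        exact posSemidef_diagonal_iff.2 fun _ => le_rfl
  · rintro ⟨Z, ⟨U, hU, z, hz, hZU⟩, hpsd⟩
    rw [hspec_iff] at hz
    have hquad : ∀ (u : Fin n → ℝ) (c : ℝ),
        0 ≤ u ⬝ᵥ ((Vᵀ * diagonal x * V - Z) *ᵥ u) + 2 * c * (y ⬝ᵥ u) + c ^ 2 * s := by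
      intro u c
      have h := hpsd.dotProduct_mulVec_nonneg (V *ᵥ u + c • fun _ => (1 : ℝ))
      rwa [star_trivial, quadForm_add_smul_one hV1 hV2 Z x u c] at h
    -- `s ≥ 0` (test with `w = 𝟙`)
    have hs0 : 0 ≤ s := by
      have h := hquad 0 1
      simpa using h
    rcases hs0.lt_or_eq with hs | hs
    · -- `S - Z ⪰ 0`
      have hZsymm : Z.IsHermitian := by
        rw [hZU]
        exact isHermitian_conj_diagonal U z
      have hP : (S - Z).PosSemidef := by
        refine PosSemidef.of_dotProduct_mulVec_nonneg ((isHermitian_schur x s).sub hZsymm)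
          fun u => ?_
        rw [star_trivial]
        have h := hquad u (-(y ⬝ᵥ u) / s)
        have hSZ : u ⬝ᵥ ((S - Z) *ᵥ u) =
            u ⬝ᵥ ((Vᵀ * diagonal x * V - Z) *ᵥ u) - s⁻¹ * (y ⬝ᵥ u) ^ 2 := by
          have hSZ' : S - Z = (Vᵀ * diagonal x * V - Z) - s⁻¹ • vecMulVec y y := by
            rw [hS_def]
            abel
          rw [hSZ', sub_mulVec, dotProduct_sub, smul_mulVec, hvv, dotProduct_smul, dotProduct_smul,
            dotProduct_comm u y, smul_eq_mul, smul_eq_mul]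
          ring
        rw [hSZ]
        have : 2 * (-(y ⬝ᵥ u) / s) * (y ⬝ᵥ u) + (-(y ⬝ᵥ u) / s) ^ 2 * s =
            -(s⁻¹ * (y ⬝ᵥ u) ^ 2) := by
          field_simp
          ring
        linarith
      -- `S = Z + (S - Z)` lies in the spectral set
      obtain ⟨U', p, hU', hp, hPU⟩ := exists_orthogonal_conj_diagonal_of_posSemidef hP
      have hPspec : S - Z ∈ {Y : Matrix (Fin n) (Fin n) ℝ | ∃ U : Matrix (Fin n) (Fin n) ℝ,
          U * Uᵀ = 1 ∧ ∃ z ∈ hyperbolicityCone (esymm (Fin n) ℝ d) (fun _ => (1 : ℝ)),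
            Y = U * diagonal z * Uᵀ} :=
        ⟨U', hU', p, mem_hyperbolicityCone_esymm_of_nonneg hdn hp, hPU⟩
      have hZspec : Z ∈ {Y : Matrix (Fin n) (Fin n) ℝ | ∃ U : Matrix (Fin n) (Fin n) ℝ,
          U * Uᵀ = 1 ∧ ∃ z ∈ hyperbolicityCone (esymm (Fin n) ℝ d) (fun _ => (1 : ℝ)),
            Y = U * diagonal z * Uᵀ} :=
        ⟨U, hU, z, (hspec_iff z).2 hz, hZU⟩
      have hSspec := add_mem_spec_of_convex
        (fun w hw c hc => smul_mem_hyperbolicityCone_esymm hdn hw hc.le) hconv hZspec hPspec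
      rw [add_sub_cancel] at hSspec
      obtain ⟨U'', hU'', dS, hdS, hSU''⟩ := hSspec
      rw [hspec_iff] at hdS
      intro i hi
      rcases Nat.eq_zero_or_pos i with rfl | hi0
      · simp [MvPolynomial.esymm_zero]
      · obtain ⟨j, rfl⟩ := Nat.exists_eq_add_of_le' hi0
        have hid := esymm_eigenvalues_schurCompression hV3 x hs.ne' hU'' hSU'' (by omega : j ≤ n)
        have h := mul_nonneg hs.le (hdS j (by omega))
        rw [hid] at h
        exact nonneg_of_mul_nonneg_right h (by positivity)
    · -- `s = 0`: then `Vᵀ x = 0` and `x = 0`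
      have hy0 : y = 0 := by
        by_contra hy
        have hyy : 0 < y ⬝ᵥ y := by
          have h0 : 0 ≤ y ⬝ᵥ y := Finset.sum_nonneg fun i _ => mul_self_nonneg (y i)
          rcases h0.lt_or_eq with h | h
          · exact h
          · exact absurd (dotProduct_self_eq_zero.1 h.symm) hy
        set q : ℝ := y ⬝ᵥ ((Vᵀ * diagonal x * V - Z) *ᵥ y) with hq
        have h := hquad y (-(q + 1) / (2 * (y ⬝ᵥ y)))
        rw [← hs, mul_zero, add_zero] at h
        have : 2 * (-(q + 1) / (2 * (y ⬝ᵥ y))) * (y ⬝ᵥ y) = -(q + 1) := by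
          field_simp
        rw [this] at h
        linarith
      have hx0 : x = 0 := by
        have h := mulVec_transpose_mulVec hV3 x
        rw [← hy_def, hy0, mulVec_zero, ← hs_def, ← hs, mul_zero, zero_smul, sub_zero] at h
        exact h.symm
      intro j hj
      rw [hx0]
      rcases Nat.eq_zero_or_pos j with rfl | hj0
      · simp [MvPolynomial.esymm_zero]
      · rw [show (0 : Fin (n + 1) → ℝ) = (0 : ℝ) • (0 : Fin (n + 1) → ℝ) by simp, eval_smul_esymm,
          zero_pow hj0.ne', zero_mul]

end Prop3

/-! ### Semidefinite lifts: base cases and the two steps -/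

section Lifts

/-- Permutation invariance of `Λ₊(e_d, 𝟙)`. [cite: SaundersonParrilo2014, §1.2 (Symmetry)] -/
theorem comp_perm_mem_cone {N d : ℕ} :
    ∀ z ∈ hyperbolicityCone (esymm (Fin N) ℝ d) (fun _ => (1 : ℝ)), ∀ σ : Equiv.Perm (Fin N),
      z ∘ σ ∈ hyperbolicityCone (esymm (Fin N) ℝ d) (fun _ => (1 : ℝ)) :=
  fun z hz σ => (comp_perm_mem_hyperbolicityCone_esymm_iff d z σ).2 hz

/-- **Base case of the derivative-based recursion**: the orthant `Λ₊(e_N, 𝟙) = ℝ^N_+` is the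
diagonal slice of `S^N_+` (size `N`). [cite: SaundersonParrilo2014, §2 (base case S^{n-k,(0)}_+)] -/
theorem hasExpPsdLift_cone_self (N : ℕ) :
    HasExpPsdLift (hyperbolicityCone (esymm (Fin N) ℝ N) (fun _ => (1 : ℝ))) 0 N := by
  have h := hasExpPsdLift_posSemidef (Matrix.diagonalLinearMap (Fin N) ℝ ℝ)
  have hc := hyperbolicityCone_esymm_card (σ := Fin N)
  rw [Fintype.card_fin] at hc
  have hset : {x : Fin N → ℝ | (Matrix.diagonalLinearMap (Fin N) ℝ ℝ x).PosSemidef} =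
      hyperbolicityCone (esymm (Fin N) ℝ N) (fun _ => (1 : ℝ)) := by
    rw [hc]
    ext x
    simp only [Set.mem_setOf_eq]
    change (diagonal x).PosSemidef ↔ _
    rw [posSemidef_diagonal_iff]
  rwa [hset] at h

/-- **Base case of the polar recursion**: the half-space `Λ₊(e₁, 𝟙) = {∑ xᵢ ≥ 0}` (size `1`).
[cite: SaundersonParrilo2014, §2 (base case S^{k+1,(k)}_+, a half-space)] -/
theorem hasExpPsdLift_cone_one {N : ℕ} (hN : 1 ≤ N) :
    HasExpPsdLift (hyperbolicityCone (esymm (Fin N) ℝ 1) (fun _ => (1 : ℝ))) 0 1 := by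
  have h := hasExpPsdLift_halfSpace_psd (-(∑ i : Fin N, LinearMap.proj i) : (Fin N → ℝ) →ₗ[ℝ] ℝ) 0
  have hset : {x : Fin N → ℝ | (-(∑ i : Fin N, LinearMap.proj i) : (Fin N → ℝ) →ₗ[ℝ] ℝ) x ≤ 0} =
      hyperbolicityCone (esymm (Fin N) ℝ 1) (fun _ => (1 : ℝ)) := by
    ext x
    rw [Set.mem_setOf_eq, mem_hyperbolicityCone_esymm_one_iff (by simpa using hN)]
    simp only [LinearMap.neg_apply, LinearMap.coe_sum, Finset.sum_apply, LinearMap.proj_apply,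
      neg_nonpos]
  rwa [hset] at h

/-- The congruence `M ↦ P M Pᵀ` as a linear map. [folklore] -/
theorem exists_conjLinearMap {a b : ℕ} (P : Matrix (Fin a) (Fin b) ℝ) :
    ∃ L : Matrix (Fin b) (Fin b) ℝ →ₗ[ℝ] Matrix (Fin a) (Fin a) ℝ, ∀ M, L M = P * M * Pᵀ :=
  ⟨{ toFun := fun M => P * M * Pᵀ
     map_add' := fun M M' => by rw [Matrix.mul_add, Matrix.add_mul]
     map_smul' := fun c M => by
       simp only [RingHom.id_apply]
       rw [Matrix.mul_smul, Matrix.smul_mul] }, fun _ => rfl⟩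

/-- **Derivative-based step (Prop. 2 + Prop. 1)**: a lift of `Λ₊^{ℝⁿ}(e_d, 𝟙)` of psd-size `r`
(`d ≤ n`) gives a lift of `Λ₊^{ℝ^{n+1}}(e_d, 𝟙)` of psd-size `r + 2 + n(2n+1)`.
[cite: SaundersonParrilo2014, §2 (derivative-based recursion (5)), Props. 1–2] -/
theorem hasExpPsdLift_cone_succ_of_compression {n d r : ℕ} (hd : d ≤ n)
    (h : HasExpPsdLift (hyperbolicityCone (esymm (Fin n) ℝ d) (fun _ => (1 : ℝ))) 0 r) :
    HasExpPsdLift (hyperbolicityCone (esymm (Fin (n + 1)) ℝ d) (fun _ => (1 : ℝ))) 0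
      (r + 2 + n * (2 * n + 1)) := by
  obtain ⟨V, -, -, hV3⟩ := exists_compressionMatrix n
  have hspec := hasExpPsdLift_spectralSet h comp_perm_mem_cone
  obtain ⟨K, hK⟩ := exists_conjLinearMap Vᵀ
  have h2 := hspec.comap_linearMap (K.comp (Matrix.diagonalLinearMap (Fin (n + 1)) ℝ ℝ))
  have hset : (K.comp (Matrix.diagonalLinearMap (Fin (n + 1)) ℝ ℝ)) ⁻¹'
      {Y : Matrix (Fin n) (Fin n) ℝ | ∃ U : Matrix (Fin n) (Fin n) ℝ, U * Uᵀ = 1 ∧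
        ∃ z ∈ hyperbolicityCone (esymm (Fin n) ℝ d) (fun _ => (1 : ℝ)), Y = U * diagonal z * Uᵀ} =
      hyperbolicityCone (esymm (Fin (n + 1)) ℝ d) (fun _ => (1 : ℝ)) := by
    ext x
    rw [Set.mem_preimage, Set.mem_setOf_eq, mem_cone_iff_compression_mem_spec hV3 hd x,
      LinearMap.comp_apply, hK, transpose_transpose]
    rfl
  rwa [hset] at h2

/-- **Polar step (Prop. 3 + Prop. 1)**: a lift of `Λ₊^{ℝⁿ}(e_d, 𝟙)` of psd-size `r` (`1 ≤ d`,
`d + 1 ≤ n`) gives a lift of `Λ₊^{ℝ^{n+1}}(e_{d+1}, 𝟙)` of psd-size `r + 2 + n(2n+1) + (n+1)`.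
[cite: SaundersonParrilo2014, §2 (polar derivative-based recursion (6)), Props. 1, 3] -/
theorem hasExpPsdLift_cone_succ_of_schur {n d r : ℕ} (hd1 : 1 ≤ d) (hd : d + 1 ≤ n)
    (h : HasExpPsdLift (hyperbolicityCone (esymm (Fin n) ℝ d) (fun _ => (1 : ℝ))) 0 r) :
    HasExpPsdLift (hyperbolicityCone (esymm (Fin (n + 1)) ℝ (d + 1)) (fun _ => (1 : ℝ))) 0
      (r + 2 + n * (2 * n + 1) + (n + 1)) := by
  obtain ⟨V, hV1, hV2, hV3⟩ := exists_compressionMatrix n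
  have hspec := hasExpPsdLift_spectralSet h comp_perm_mem_cone
  have hconv := hspec.convex
  obtain ⟨K, hK⟩ := exists_conjLinearMap V
  set M : (Fin (n + 1) → ℝ) × Matrix (Fin n) (Fin n) ℝ →ₗ[ℝ] Matrix (Fin (n + 1)) (Fin (n + 1)) ℝ :=
    (Matrix.diagonalLinearMap (Fin (n + 1)) ℝ ℝ).comp (LinearMap.fst ℝ _ _) -
      K.comp (LinearMap.snd ℝ _ _) with hM
  have hMapply : ∀ (x : Fin (n + 1) → ℝ) (Z : Matrix (Fin n) (Fin n) ℝ),
      M (x, Z) = diagonal x - V * Z * Vᵀ := by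
    intro x Z
    rw [hM, LinearMap.sub_apply, LinearMap.comp_apply, LinearMap.comp_apply, LinearMap.fst_apply,
      LinearMap.snd_apply, hK]
    rfl
  have hA := ((hspec.comap_linearMap (LinearMap.snd ℝ (Fin (n + 1) → ℝ) _)).inter
    (hasExpPsdLift_posSemidef M)).fst_image
  have hset : Prod.fst '' ((LinearMap.snd ℝ (Fin (n + 1) → ℝ) (Matrix (Fin n) (Fin n) ℝ)) ⁻¹'
      {Y : Matrix (Fin n) (Fin n) ℝ | ∃ U : Matrix (Fin n) (Fin n) ℝ, U * Uᵀ = 1 ∧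
        ∃ z ∈ hyperbolicityCone (esymm (Fin n) ℝ d) (fun _ => (1 : ℝ)), Y = U * diagonal z * Uᵀ} ∩
      {p | (M p).PosSemidef}) =
      hyperbolicityCone (esymm (Fin (n + 1)) ℝ (d + 1)) (fun _ => (1 : ℝ)) := by
    ext x
    rw [mem_cone_iff_exists_spec_schur hV1 hV2 hV3 hd1 hd hconv x]
    simp only [Set.mem_image, Set.mem_inter_iff, Set.mem_preimage, LinearMap.snd_apply,
      Set.mem_setOf_eq, Prod.exists, exists_and_right, exists_eq_right, hMapply]
  rwa [hset] at hA

end Lifts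

/-! ### The two recursions and the size count (§2.2) -/

section Recursions

/-- **Derivative-based recursion (5)**: `Λ₊^{ℝ^{d+j}}(e_d, 𝟙)` has a lift of psd-size
`d + j (2 + (d+j)(2(d+j)+1))` (start from the orthant `ℝ^d_+`, apply the derivative-based step
`j` times). [cite: SaundersonParrilo2014, §2.2] -/
theorem hasExpPsdLift_cone_deriv (d j : ℕ) :
    HasExpPsdLift (hyperbolicityCone (esymm (Fin (d + j)) ℝ d) (fun _ => (1 : ℝ))) 0
      (d + j * (2 + (d + j) * (2 * (d + j) + 1))) := by
  induction j with
  | zero => exact (hasExpPsdLift_cone_self d).mono le_rfl (by omega)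
  | succ j ih =>
    have h := hasExpPsdLift_cone_succ_of_compression (n := d + j) (d := d) (by omega) ih
    refine h.mono le_rfl ?_
    have hc : 2 + (d + j) * (2 * (d + j) + 1) ≤ 2 + (d + j + 1) * (2 * (d + j + 1) + 1) := by
      nlinarith
    calc d + j * (2 + (d + j) * (2 * (d + j) + 1)) + 2 + (d + j) * (2 * (d + j) + 1)
        = d + (j + 1) * (2 + (d + j) * (2 * (d + j) + 1)) := by ring
      _ ≤ d + (j + 1) * (2 + (d + (j + 1)) * (2 * (d + (j + 1)) + 1)) :=
          Nat.add_le_add_left (Nat.mul_le_mul_left _ hc) _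

/-- **Polar recursion (6)**: `Λ₊^{ℝ^{b+j}}(e_{j+1}, 𝟙)` (`b ≥ 2`) has a lift of psd-size
`1 + j (2 + (b+j)(2(b+j)+1) + (b+j+1))` (start from the half-space, apply the polar step `j`
times). [cite: SaundersonParrilo2014, §2.2] -/
theorem hasExpPsdLift_cone_polar {b : ℕ} (hb : 2 ≤ b) (j : ℕ) : ∀ N : ℕ, N = b + j →
    HasExpPsdLift (hyperbolicityCone (esymm (Fin N) ℝ (j + 1)) (fun _ => (1 : ℝ))) 0
      (1 + j * (2 + (b + j) * (2 * (b + j) + 1) + (b + j + 1))) := by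
  induction j with
  | zero =>
    intro N hN
    rw [hN]
    exact (hasExpPsdLift_cone_one (N := b) (by omega)).mono le_rfl (by omega)
  | succ j ih =>
    intro N hN
    rw [hN]
    have ih' := ih (b + j) rfl
    have h := hasExpPsdLift_cone_succ_of_schur (n := b + j) (d := j + 1) (by omega) (by omega) ih'
    refine h.mono le_rfl ?_
    have hc : 2 + (b + j) * (2 * (b + j) + 1) + (b + j + 1) ≤
        2 + (b + j + 1) * (2 * (b + j + 1) + 1) + (b + j + 1 + 1) := by
      nlinarith
    calc 1 + j * (2 + (b + j) * (2 * (b + j) + 1) + (b + j + 1)) + 2 + (b + j) * (2 * (b + j) + 1) +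
          (b + j + 1)
        = 1 + (j + 1) * (2 + (b + j) * (2 * (b + j) + 1) + (b + j + 1)) := by ring
      _ ≤ 1 + (j + 1) * (2 + (b + (j + 1)) * (2 * (b + (j + 1)) + 1) + (b + (j + 1) + 1)) :=
          Nat.add_le_add_left (Nat.mul_le_mul_left _ hc) _

end Recursions

/-! ### Theorem 1 (orthant form) -/

/-- **Saunderson–Parrilo 2015, Theorem 1 (orthant form)**, discharging the named fact
`SaundersonParrilo2014_thm1_orthant`: for `1 ≤ k ≤ n-1` the derivative relaxation
`ℝ^{n,(k)}_+ = Λ₊(e_{n-k}, 𝟙)` of the orthant has a lifted LMI representation of size at most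
`8 · min{k, n-k} · n²` (derivative-based recursion when `k ≤ n-k`, polar recursion otherwise).
[cite: SaundersonParrilo2014, Theorem 1; §2.2] -/
theorem SaundersonParrilo2014_thm1_orthant_holds : SaundersonParrilo2014_thm1_orthant := by
  refine ⟨8, fun n k hk hkn => ?_⟩
  obtain ⟨d, rfl⟩ : ∃ d, n = d + k := ⟨n - k, by omega⟩
  rw [Nat.add_sub_cancel]
  have hd1 : 1 ≤ d := by omega
  -- the two lifts
  have h1 := hasExpPsdLift_cone_deriv d k
  obtain ⟨d', rfl⟩ : ∃ d', d = d' + 1 := ⟨d - 1, by omega⟩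
  have h2 := hasExpPsdLift_cone_polar (b := k + 1) (by omega) d' (d' + 1 + k) (by omega)
  -- sizes, with `N = n = d' + 1 + k`
  obtain ⟨N, hN⟩ : ∃ N, N = d' + 1 + k := ⟨_, rfl⟩
  have hN' : k + 1 + d' = N := by omega
  have hN1 : 1 ≤ N := by omega
  have hNN : N ≤ N ^ 2 := Nat.le_self_pow two_ne_zero N
  have hN2 : 1 ≤ N ^ 2 := hN1.trans hNN
  rw [← hN] at h1
  rw [hN', ← hN] at h2
  rw [← hN]
  by_cases hkd : k ≤ d' + 1
  · refine ⟨_, ?_, isSpectrahedralShadowOfSize_of_hasExpPsdLift h1⟩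
    rw [min_eq_left hkd]
    have ha : d' + 1 ≤ k * N ^ 2 :=
      calc d' + 1 ≤ N := by omega
        _ ≤ k * N := Nat.le_mul_of_pos_left N hk
        _ ≤ k * N ^ 2 := Nat.mul_le_mul_left k hNN
    have hb : k ≤ k * N ^ 2 := Nat.le_mul_of_pos_right k hN2
    have hc : k * N ≤ k * N ^ 2 := Nat.mul_le_mul_left k hNN
    linarith
  · refine ⟨_, ?_, isSpectrahedralShadowOfSize_of_hasExpPsdLift h2⟩
    rw [min_eq_right (by omega)]
    have hb : d' ≤ d' * N ^ 2 := Nat.le_mul_of_pos_right d' hN2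
    have hc : d' * N ≤ d' * N ^ 2 := Nat.mul_le_mul_left d' hNN
    linarith

end Literature.AlgebraicGeometry.HyperbolicPolynomials

end
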